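import Mathlib
import HarnessLib.Audit
import Summits.PneNP.PneNP.Theorems.PstarSkeletalSubcores
import Summits.PneNP.PneNP.Theorems.PstarShortCoincidenceEndpoints

/-!
# NO FREE VERTEX: every XOR vertex of a terminal core lies on a non-chord or on a chord with an inside gate (ROUND-24, O1; all core sizes)

FRONTIER range-avoidance ladder, rung F-N3, ROUND 24 (cell `pnp-ideate`, prover-2 memo `g24/O1-NOFREEVERTEX-g24.md` §31; typed targets
`PstarCoreBoundTargets.TerminalFive` / `TerminalPeelable` (p646951); restricted-model proof complexity — nothing here bears on `P` versus `NP`).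

A vertex `u` of the XOR graph of a family `K` is FREE for the menu `M` when every member of `K` reading `u` is an OUTSIDE-GATED CHORD of `K`
(`PstarChordReadOutside.OutsideGated`: both AND variables private to `K`, every monomial of `M` touching them a gate whose partner is read by no
member of `K`).

* **`false_of_freeVertex`** — a terminal core `(K; d₁, d₂)` (`PstarCoreBoundTargets.Terminal`) has NO free vertex for the menu `d₁.G ∪ d₂.G`.
  ALL core sizes; no Assumption A, no genericity hypothesis, no census.  Proof by strong induction on `#K`: two chords `e ≠ e'` through the free
  vertex `u` exist (`XorClosed`); each is slice-generic by the landed criterion (`PstarSliceGenericCriterion.sliceGeneric_of_criterion` for the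
  internal menu, lifted by `PstarSliceGenericInternal.sliceGeneric_of_internal`): branch (B) holds because every member of a coincidence `F₁` through
  `u` would be an outside-gated chord (`PstarShortCoincidenceEndpoints.noShortCoincidence_of_clean_endpoint`); in branch (A) a fold through `u` is a
  clean fold (`PstarSkeletalSubcores.false_of_clean_fold`), and otherwise `u` is an odd vertex of `e + F₁`, hence a vertex of the sub-core `K₁ ⊊ K`,
  which inherits the free vertex (`PstarSkeletalSubcores.outsideGated_sub_of_clean`) — induction.  Then `PstarChordReadTwoClean.false_of_two_clean`.
* `exists_nonclean_at_vertex` / `exists_nonclean_at_endpoint` — the structural reading: every XOR vertex of a terminal core (in particular every XOR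
  endpoint of every clean chord) is read by a NON-CHORD or by a chord that is NOT outside-gated (a dirty chord).  So the XOR graph of a terminal core
  is spanned by its skeleton `nonchords ∪ dirty chords` (at boundary slack `t`: at most `#sharedSlots + t` outputs), and the planner's centre-structure
  census may discard every structure with a vertex met by clean chords only (p3 `r26/tight14.py`: the "fresh" vertices at `t = 0`).
* `noPathSumSubcore_of_free_endpoint`, `sliceGeneric_of_free_endpoint` — the (A)-half and the genericity of a chord with a free endpoint in an
  ARBITRARY family (the (B)-half is `PstarShortCoincidenceEndpoints.noShortCoincidence_of_clean_endpoint`); `noSkeletalPathSumSubcore_of_free_endpoint`.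
* `Covered`, `covered_of_terminal`, `CleanCoveredCriterionBound` (OPEN, census-type): `PstarSkeletalSubcores.CleanSkeletalCriterionBound` restricted
  to COVERED centre structures (every XOR vertex on a non-clean output); `cleanSkeletalCriterionBound_of_covered`, and
  **`terminalFive_of_coveredBound : TerminalFiveA → CleanCoveredCriterionBound → TerminalFive`** (+ `terminalPeelable_of_coveredBound`).
-/

set_option linter.dupNamespace false -- `Summit.PneNP.PneNP.…`: summit = sub-problem name (D-0017 single-conjunct layout)

open Finset Literature.Computability.Complexity
open Summit.PneNP.PneNP.Theorems.PstarTyped (Typed)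
open Summit.PneNP.PneNP.Theorems.PstarSALevel (varSet bdry BoundaryExpanding SimpleOverlap)
open Summit.PneNP.PneNP.Theorems.PstarXCore (xpair mem_xpair xverts)
open Summit.PneNP.PneNP.Theorems.PstarCentreFree (vars_mem_varSet)
open Summit.PneNP.PneNP.Theorems.PstarCoreBound (XorClosed)
open Summit.PneNP.PneNP.Theorems.PstarChordRepair (IsChord)
open Summit.PneNP.PneNP.Theorems.PstarCoreBoundTargets (Terminal TerminalFive TerminalFiveA TerminalPeelable terminalPeelable_of_terminalFive)
open Summit.PneNP.PneNP.Theorems.PstarSharingBound (sharedSlots)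
open Summit.PneNP.PneNP.Theorems.PstarChordBridgeTools (xpdeg)
open Summit.PneNP.PneNP.Theorems.PstarChordBridgeFundamental (xpdeg_insert exists_mem_of_odd)
open Summit.PneNP.PneNP.Theorems.PstarChordBridgeExchange (mem_xverts_iff)
open Summit.PneNP.PneNP.Theorems.PstarNorUnitCoverTools (two_le_xpdeg_of_xorClosed exists_ne_of_two_le_xpdeg)
open Summit.PneNP.PneNP.Theorems.PstarChordReadOutside (OutsideGated)
open Summit.PneNP.PneNP.Theorems.PstarChordReadLemma (SliceGeneric)
open Summit.PneNP.PneNP.Theorems.PstarChordReadTwoClean (false_of_two_clean)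
open Summit.PneNP.PneNP.Theorems.PstarSliceGenericCriterion (NoPathSumSubcore NoShortCoincidence sliceGeneric_of_criterion)
open Summit.PneNP.PneNP.Theorems.PstarSliceGenericInternal (internalMenu internalMenu_subset sliceGeneric_of_internal)
open Summit.PneNP.PneNP.Theorems.PstarSkeletalSubcores (NoSkeletalPathSumSubcore CleanSkeletalCriterionBound false_of_clean_fold
  outsideGated_sub_of_clean terminalFive_of_skeletalBound)
open Summit.PneNP.PneNP.Theorems.PstarShortCoincidenceEndpoints (noShortCoincidence_of_clean_endpoint)

namespace Summit.PneNP.PneNP.Theorems.PstarNoFreeVertex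

variable {n m : ℕ}

/-- **FREE VERTEX.**  `u` is a vertex of the XOR graph of `K` (in the XOR pair of some member), and every member of `K` reading `u` is an
outside-gated chord of `K` for the menu `M`. -/
def FreeVertex (I : LocalMap 4 n m) (K M : Finset (Fin m)) (u : Fin n) : Prop :=
  (∃ f ∈ K, u ∈ xpair I f) ∧ ∀ f ∈ K, u ∈ varSet I f → IsChord I K f ∧ OutsideGated I K M f

variable {I : LocalMap 4 n m} {r : ℕ} {y : Fin m → Bool}

/-! ## Small tools -/

/-- Outside-gatedness is antitone in the menu. -/
theorem outsideGated_anti {J₀ M M' : Finset (Fin m)} {c : Fin m} (hMM : M' ⊆ M) (h : OutsideGated I J₀ M c) : OutsideGated I J₀ M' c :=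
  fun g hg ht => h g (hMM hg) ht

/-- The XOR pair of an output is read by it. -/
theorem mem_varSet_of_mem_xpair {f : Fin m} {u : Fin n} (h : u ∈ xpair I f) : u ∈ varSet I f := by
  rcases (mem_xpair I).1 h with rfl | rfl
  exacts [vars_mem_varSet I f 0, vars_mem_varSet I f 1]

/-- An XOR slot variable is in the XOR pair of its output. -/
theorem vars_mem_xpair (c : Fin m) {s : Fin 4} (hs : s.val < 2) : I.vars c s ∈ xpair I c := by
  have h4 : ∀ t : Fin 4, t.val < 2 → t = 0 ∨ t = 1 := by decide
  rcases h4 s hs with rfl | rfl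
  exacts [(mem_xpair I).2 (Or.inl rfl), (mem_xpair I).2 (Or.inr rfl)]

/-- On a typed instance an XOR-slot variable read by an output is in that output's XOR pair. -/
theorem mem_xpair_of_mem_varSet (hT : Typed I) {e f : Fin m} {s : Fin 4} (hs : s.val < 2) (h : I.vars e s ∈ varSet I f) :
    I.vars e s ∈ xpair I f := by
  unfold PstarSALevel.varSet at h
  obtain ⟨s', -, hs'⟩ := mem_image.1 h
  by_cases h2 : s'.val < 2
  · have h4 : ∀ t : Fin 4, t.val < 2 → t = 0 ∨ t = 1 := by decide
    rcases h4 s' h2 with rfl | rfl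
    exacts [(mem_xpair I).2 (Or.inl hs'.symm), (mem_xpair I).2 (Or.inr hs'.symm)]
  · exact absurd hs'.symm (hT e f s s' hs (Nat.le_of_not_lt h2))

/-! ## The branch-(A) dichotomy at a free endpoint: a clean fold, or a sub-core with the same free vertex -/

/-- **A path-sum sub-core of a chord `c` whose endpoint `vars c s` is free either folds an outside-gated chord of `J₀` or has `vars c s` as a free
vertex** (for its own menu).  Pure combinatorics of the (A)-data: if no fold of the first reader passes through the endpoint, the endpoint is an odd
vertex of `c + F₁`, hence read by the sub-core, whose members through it are outside-gated chords of `J₀` untouched by the sub-core's menu. -/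
theorem cleanFold_or_freeVertex (hI : I.IsPure xorAndPred) (hT : Typed I) {J₀ 𝒢 K₀ F₁ : Finset (Fin m)} {c : Fin m}
    {d₁ d₂ : Finset (Fin n) × Finset (Fin m) × Bool} (hK₀ : K₀ ⊆ J₀.erase c) (hF₁ : F₁ ⊆ J₀.erase c \ K₀) (hm₁ : d₁.2.1 = F₁)
    (hmono : d₁.2.1 ∪ d₂.2.1 ⊆ internalMenu I J₀ 𝒢 ∪ (J₀ \ K₀)) (hlin : ∀ v, v ∈ d₁.1 ↔ Odd (xpdeg I (insert c F₁) v))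
    (hread : ∀ v ∈ d₁.1, ∃ f ∈ K₀, v ∈ varSet I f) {s : Fin 4} (hs : s.val < 2)
    (hfree : ∀ f ∈ J₀.erase c, I.vars c s ∈ varSet I f → IsChord I J₀ f ∧ OutsideGated I J₀ 𝒢 f) :
    (∃ f ∈ d₁.2.1 ∪ d₂.2.1, f ∈ J₀ ∧ IsChord I J₀ f ∧ OutsideGated I J₀ 𝒢 f) ∨ FreeVertex I K₀ (d₁.2.1 ∪ d₂.2.1) (I.vars c s) := by
  classical
  have hcF : c ∉ F₁ := fun h => (mem_erase.1 (mem_sdiff.1 (hF₁ h)).1).1 rfl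
  have hK₀J : K₀ ⊆ J₀ := hK₀.trans (erase_subset c J₀)
  by_cases hfold : ∃ f ∈ F₁, I.vars c s ∈ xpair I f
  · obtain ⟨f, hf, huf⟩ := hfold
    have hfJ : f ∈ J₀.erase c := (mem_sdiff.1 (hF₁ hf)).1
    obtain ⟨hch, hO⟩ := hfree f hfJ (mem_varSet_of_mem_xpair huf)
    have hfm : f ∈ d₁.2.1 := by rw [hm₁]; exact hf
    exact Or.inl ⟨f, mem_union_left _ hfm, mem_of_mem_erase hfJ, hch, hO⟩
  · push Not at hfold
    right
    have hodd : Odd (xpdeg I (insert c F₁) (I.vars c s)) := by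
      have heven : Even (xpdeg I F₁ (I.vars c s)) := by
        rcases Nat.even_or_odd (xpdeg I F₁ (I.vars c s)) with h | h
        · exact h
        · obtain ⟨f, hf, huf⟩ := exists_mem_of_odd I h
          exact absurd huf (hfold f hf)
      have h01 : I.vars c 0 ≠ I.vars c 1 := fun h => absurd (hI.2 c h) (by decide)
      have h4 : ∀ t : Fin 4, t.val < 2 → t = 0 ∨ t = 1 := by decide
      rw [xpdeg_insert I hcF]
      rcases h4 s hs with rfl | rfl
      · rw [if_pos rfl, if_neg fun h => h01 h.symm]
        simpa using heven.add_one
      · rw [if_neg h01, if_pos rfl]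
        simpa using heven.add_one
    obtain ⟨g₁, hg₁, hug₁⟩ := hread _ ((hlin _).2 hodd)
    refine ⟨⟨g₁, hg₁, mem_xpair_of_mem_varSet hT hs hug₁⟩, fun f hf huf => ?_⟩
    obtain ⟨hch, hO⟩ := hfree f (hK₀ hf) huf
    exact outsideGated_sub_of_clean hK₀J hmono hf hch hO

/-! ## The theorem -/

/-- **NO FREE VERTEX.**  A terminal core `(K; d₁, d₂)` of a pure typed `(r,3/2)`-expanding instance with simple overlaps has no free vertex for the
menu `d₁.G ∪ d₂.G`: every XOR vertex of `K` is read by a member of `K` that is not an outside-gated chord.  All core sizes. -/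
theorem false_of_freeVertex (hI : I.IsPure xorAndPred) (hT : Typed I) (hS : SimpleOverlap I) (hB : BoundaryExpanding r I)
    {K : Finset (Fin m)} {d₁ d₂ : Finset (Fin n) × Finset (Fin m) × Bool} (ht : Terminal I r y K d₁ d₂) {u : Fin n}
    (hu : FreeVertex I K (d₁.2.1 ∪ d₂.2.1) u) : False := by
  classical
  suffices H : ∀ (k : ℕ) (K : Finset (Fin m)) (d₁ d₂ : Finset (Fin n) × Finset (Fin m) × Bool) (u : Fin n),
      K.card = k → Terminal I r y K d₁ d₂ → FreeVertex I K (d₁.2.1 ∪ d₂.2.1) u → False from H _ K d₁ d₂ u rfl ht hu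
  intro k
  induction k using Nat.strong_induction_on with
  | _ k ih =>
    intro K d₁ d₂ u hk ht hu
    obtain ⟨⟨f₀, hf₀, huf₀⟩, hfree⟩ := hu
    have hX : XorClosed I K := ht.2.1
    have hKr : K.card < r := ht.2.2.1
    have hdisj : Disjoint K (d₁.2.1 ∪ d₂.2.1) := disjoint_union_right.2 ⟨ht.2.2.2.1, ht.2.2.2.2.1⟩
    have hr : (K ∪ (d₁.2.1 ∪ d₂.2.1)).card ≤ r := by rw [← union_assoc]; exact ht.2.2.2.2.2.1
    -- a second member of `K` through `u`
    have hux : u ∈ xverts I K := (mem_xverts_iff I K u).2 ⟨f₀, hf₀, huf₀⟩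
    obtain ⟨f₁, hf₁, hne, huf₁⟩ := exists_ne_of_two_le_xpdeg I hI f₀ (two_le_xpdeg_of_xorClosed I hT hX u hux)
    -- every member through `u` is slice-generic
    have hgen : ∀ e ∈ K, u ∈ xpair I e → SliceGeneric I y K e (d₁.2.1 ∪ d₂.2.1) := by
      intro e he hue
      obtain ⟨hch, hO⟩ := hfree e he (mem_varSet_of_mem_xpair hue)
      obtain ⟨s, hs, hsu⟩ : ∃ s : Fin 4, s.val < 2 ∧ I.vars e s = u := by
        rcases (mem_xpair I).1 hue with h | h
        · exact ⟨0, by decide, h.symm⟩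
        · exact ⟨1, by decide, h.symm⟩
      subst hsu
      have hM' : internalMenu I K (d₁.2.1 ∪ d₂.2.1) ⊆ d₁.2.1 ∪ d₂.2.1 := internalMenu_subset I K _
      have hfree' : ∀ f ∈ K.erase e, I.vars e s ∈ varSet I f → IsChord I K f ∧ OutsideGated I K (d₁.2.1 ∪ d₂.2.1) f :=
        fun f hf h => hfree f (mem_of_mem_erase hf) h
      -- branch (B): a coincidence through `u` would contain an outside-gated chord
      have hBe : NoShortCoincidence I K e (internalMenu I K (d₁.2.1 ∪ d₂.2.1)) :=
        noShortCoincidence_of_clean_endpoint hI hs fun f hf h => ⟨(hfree' f hf h).1, outsideGated_anti hM' (hfree' f hf h).2⟩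
      -- branch (A): a clean fold, or a smaller terminal core with the same free vertex
      have hAe : NoPathSumSubcore I r y K e (internalMenu I K (d₁.2.1 ∪ d₂.2.1)) := by
        intro K₁ hK₁ hK₁ne hX₁ F F' t d₁' d₂' hF hF' hm₁ hm₂ hlin hread hslice ht₁
        have hK₁K : K₁ ⊆ K := hK₁.trans (erase_subset e K)
        have hsd : (K.erase e) \ K₁ ⊆ K \ K₁ := sdiff_subset_sdiff (erase_subset e K) (Subset.refl _)
        have hmono : d₁'.2.1 ∪ d₂'.2.1 ⊆ internalMenu I K (d₁.2.1 ∪ d₂.2.1) ∪ (K \ K₁) := by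
          refine union_subset ?_ (hm₂.trans (union_subset_union (Subset.refl _) (hF'.trans hsd)))
          rw [hm₁]
          exact (hF.trans hsd).trans subset_union_right
        rcases cleanFold_or_freeVertex hI hT hK₁ hF hm₁ hmono hlin hread hs hfree' with ⟨f, hf, hfK, hchf, hOf⟩ | hu₁
        · exact false_of_clean_fold hI hT hS hB ht₁ hK₁K hdisj hmono hf hfK hchf hOf
        · have hlt : K₁.card < k := by
            rw [← hk]
            exact lt_of_le_of_lt (card_le_card hK₁) (card_erase_lt_of_mem he)
          exact ih K₁.card hlt K₁ d₁' d₂' (I.vars e s) rfl ht₁ hu₁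
      have hdisj' : Disjoint K (internalMenu I K (d₁.2.1 ∪ d₂.2.1)) := hdisj.mono_right hM'
      have hr' : (K ∪ internalMenu I K (d₁.2.1 ∪ d₂.2.1)).card ≤ r :=
        (card_le_card (union_subset_union (Subset.refl _) hM')).trans hr
      exact sliceGeneric_of_internal hI hT hS hB hKr.le he hch hO (sliceGeneric_of_criterion hI hT hS hB he hdisj' hr' hAe hBe)
    obtain ⟨hch₀, hO₀⟩ := hfree f₀ hf₀ (mem_varSet_of_mem_xpair huf₀)
    obtain ⟨hch₁, hO₁⟩ := hfree f₁ hf₁ (mem_varSet_of_mem_xpair huf₁)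
    exact false_of_two_clean hI hT hS hB ht hf₀ hf₁ hne.symm hch₀ hch₁ hO₀ hO₁ (hgen f₀ hf₀ huf₀) (hgen f₁ hf₁ huf₁)

/-! ## The structural reading: terminal cores are covered by their non-clean outputs -/
section Structure

variable {J₀ : Finset (Fin m)} {w₁ w₂ : Finset (Fin n) × Finset (Fin m) × Bool}

/-- **EVERY XOR VERTEX OF A TERMINAL CORE LIES ON A NON-CHORD OR ON A CHORD THAT IS NOT OUTSIDE-GATED.** -/
theorem exists_nonclean_at_vertex (hI : I.IsPure xorAndPred) (hT : Typed I) (hS : SimpleOverlap I) (hB : BoundaryExpanding r I)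
    (ht : Terminal I r y J₀ w₁ w₂) {u : Fin n} (hu : u ∈ xverts I J₀) :
    ∃ f ∈ J₀, u ∈ xpair I f ∧ ¬ (IsChord I J₀ f ∧ OutsideGated I J₀ (w₁.2.1 ∪ w₂.2.1) f) := by
  by_contra h
  push Not at h
  obtain ⟨f₀, hf₀, huf₀⟩ := (mem_xverts_iff I J₀ u).1 hu
  obtain ⟨s, hs, hsu⟩ : ∃ s : Fin 4, s.val < 2 ∧ I.vars f₀ s = u := by
    rcases (mem_xpair I).1 huf₀ with e | e
    · exact ⟨0, by decide, e.symm⟩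
    · exact ⟨1, by decide, e.symm⟩
  subst hsu
  exact false_of_freeVertex hI hT hS hB ht ⟨⟨f₀, hf₀, huf₀⟩, fun f hf huf => h f hf (mem_xpair_of_mem_varSet hT hs huf)⟩

/-- **A CLEAN CHORD OF A TERMINAL CORE HAS NO FREE ENDPOINT**: through each XOR endpoint of an outside-gated chord `c` passes another member of
the core that is a non-chord or a chord that is not outside-gated. -/
theorem exists_nonclean_at_endpoint (hI : I.IsPure xorAndPred) (hT : Typed I) (hS : SimpleOverlap I) (hB : BoundaryExpanding r I)
    (ht : Terminal I r y J₀ w₁ w₂) {c : Fin m} (hc : c ∈ J₀) (hch : IsChord I J₀ c) (hO : OutsideGated I J₀ (w₁.2.1 ∪ w₂.2.1) c)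
    {s : Fin 4} (hs : s.val < 2) :
    ∃ f ∈ J₀.erase c, I.vars c s ∈ xpair I f ∧ ¬ (IsChord I J₀ f ∧ OutsideGated I J₀ (w₁.2.1 ∪ w₂.2.1) f) := by
  have hu : I.vars c s ∈ xverts I J₀ := (mem_xverts_iff I J₀ _).2 ⟨c, hc, vars_mem_xpair c hs⟩
  obtain ⟨f, hf, huf, hnot⟩ := exists_nonclean_at_vertex hI hT hS hB ht hu
  have hfc : f ≠ c := by
    rintro rfl
    exact hnot ⟨hch, hO⟩
  exact ⟨f, mem_erase.2 ⟨hfc, hf⟩, huf, hnot⟩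

/-- **COVERED families**: every XOR vertex of `J₀` is in the XOR pair of a member that is not an outside-gated chord (menu `𝒢`). -/
def Covered (I : LocalMap 4 n m) (J₀ 𝒢 : Finset (Fin m)) : Prop :=
  ∀ u ∈ xverts I J₀, ∃ f ∈ J₀, u ∈ xpair I f ∧ ¬ (IsChord I J₀ f ∧ OutsideGated I J₀ 𝒢 f)

/-- **Terminal cores are covered** (by their non-chords and their chords that are not outside-gated). -/
theorem covered_of_terminal (hI : I.IsPure xorAndPred) (hT : Typed I) (hS : SimpleOverlap I) (hB : BoundaryExpanding r I)
    (ht : Terminal I r y J₀ w₁ w₂) : Covered I J₀ (w₁.2.1 ∪ w₂.2.1) :=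
  fun _ hu => exists_nonclean_at_vertex hI hT hS hB ht hu

end Structure

/-! ## A chord with a free endpoint in an arbitrary family passes branch (A) and is slice-generic -/
section FreeEndpoint

variable {J₀ 𝒢 : Finset (Fin m)} {c : Fin m}

/-- **BRANCH (A) AT A FREE ENDPOINT** (internal menu, all sub-core sizes): if every member of `J₀ ∖ c` reading the XOR variable `vars c s` is an
outside-gated chord of `J₀`, then `c` has no path-sum sub-core for the internal menu. -/
theorem noPathSumSubcore_of_free_endpoint (hI : I.IsPure xorAndPred) (hT : Typed I) (hS : SimpleOverlap I) (hB : BoundaryExpanding r I)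
    (hdisj : Disjoint J₀ 𝒢) {s : Fin 4} (hs : s.val < 2)
    (hfree : ∀ f ∈ J₀.erase c, I.vars c s ∈ varSet I f → IsChord I J₀ f ∧ OutsideGated I J₀ 𝒢 f) :
    NoPathSumSubcore I r y J₀ c (internalMenu I J₀ 𝒢) := by
  intro K₀ hK₀ _ _ F₁ F₂ t d₁ d₂ hF₁ hF₂ hm₁ hm₂ hlin hread _ ht
  have hK₀J : K₀ ⊆ J₀ := hK₀.trans (erase_subset c J₀)
  have hsd : (J₀.erase c) \ K₀ ⊆ J₀ \ K₀ := sdiff_subset_sdiff (erase_subset c J₀) (Subset.refl _)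
  have hmono : d₁.2.1 ∪ d₂.2.1 ⊆ internalMenu I J₀ 𝒢 ∪ (J₀ \ K₀) := by
    refine union_subset ?_ (hm₂.trans (union_subset_union (Subset.refl _) (hF₂.trans hsd)))
    rw [hm₁]
    exact (hF₁.trans hsd).trans subset_union_right
  rcases cleanFold_or_freeVertex hI hT hK₀ hF₁ hm₁ hmono hlin hread hs hfree with ⟨f, hf, hfJ, hchf, hOf⟩ | hu
  · exact false_of_clean_fold hI hT hS hB ht hK₀J hdisj hmono hf hfJ hchf hOf
  · exact false_of_freeVertex hI hT hS hB ht hu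

/-- **The skeletal small node at a free endpoint** (the form consumed by `CleanSkeletalCriterionBound`). -/
theorem noSkeletalPathSumSubcore_of_free_endpoint (hI : I.IsPure xorAndPred) (hT : Typed I) (hS : SimpleOverlap I)
    (hB : BoundaryExpanding r I) (hdisj : Disjoint J₀ 𝒢) {s : Fin 4} (hs : s.val < 2)
    (hfree : ∀ f ∈ J₀.erase c, I.vars c s ∈ varSet I f → IsChord I J₀ f ∧ OutsideGated I J₀ 𝒢 f) :
    NoSkeletalPathSumSubcore I r y J₀ c 𝒢 :=
  fun K₀ hK₀ hne hX _ F₁ F₂ t d₁ d₂ hF₁ hF₂ hm₁ hm₂ _ _ hlin hread _ hslice ht =>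
    noPathSumSubcore_of_free_endpoint hI hT hS hB hdisj hs hfree K₀ hK₀ hne hX F₁ F₂ t d₁ d₂ hF₁ hF₂ hm₁ hm₂ hlin hread hslice ht

/-- **A CHORD WITH A FREE ENDPOINT IS SLICE-GENERIC** (any family `J₀` with `#(J₀ ∪ 𝒢) ≤ r`, menu `𝒢` disjoint from `J₀`): branch (A) by
`noPathSumSubcore_of_free_endpoint`, branch (B) by `noShortCoincidence_of_clean_endpoint`, both for the internal menu, then
`sliceGeneric_of_criterion` and `sliceGeneric_of_internal`. -/
theorem sliceGeneric_of_free_endpoint (hI : I.IsPure xorAndPred) (hT : Typed I) (hS : SimpleOverlap I) (hB : BoundaryExpanding r I)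
    (hdisj : Disjoint J₀ 𝒢) (hr : (J₀ ∪ 𝒢).card ≤ r) (hc : c ∈ J₀) (hch : IsChord I J₀ c) (hO : OutsideGated I J₀ 𝒢 c)
    {s : Fin 4} (hs : s.val < 2) (hfree : ∀ f ∈ J₀.erase c, I.vars c s ∈ varSet I f → IsChord I J₀ f ∧ OutsideGated I J₀ 𝒢 f) :
    SliceGeneric I y J₀ c 𝒢 := by
  have hM' : internalMenu I J₀ 𝒢 ⊆ 𝒢 := internalMenu_subset I J₀ 𝒢
  have hJr : J₀.card ≤ r := (card_le_card subset_union_left).trans hr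
  have hBc : NoShortCoincidence I J₀ c (internalMenu I J₀ 𝒢) :=
    noShortCoincidence_of_clean_endpoint hI hs fun f hf h => ⟨(hfree f hf h).1, outsideGated_anti hM' (hfree f hf h).2⟩
  exact sliceGeneric_of_internal hI hT hS hB hJr hc hch hO
    (sliceGeneric_of_criterion hI hT hS hB hc (hdisj.mono_right hM') ((card_le_card (union_subset_union (Subset.refl _) hM')).trans hr)
      (noPathSumSubcore_of_free_endpoint hI hT hS hB hdisj hs hfree) hBc)

end FreeEndpoint

/-! ## The census node restricted to covered centre structures, and the core bound from it -/

/-- **`CleanCoveredCriterionBound` (OPEN, census-type)**: `PstarSkeletalSubcores.CleanSkeletalCriterionBound` with the additional hypothesis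
that the terminal core is `Covered` — every XOR vertex lies on a non-chord or on a chord that is not outside-gated (no vertex met by clean chords
only).  By `covered_of_terminal` the hypothesis costs nothing.  FRONTIER. -/
@[conjecture] def CleanCoveredCriterionBound : Prop :=
  ∀ (n m r : ℕ) (I : LocalMap 4 n m), I.IsPure xorAndPred → Typed I → SimpleOverlap I → BoundaryExpanding r I →
    ∀ (y : Fin m → Bool) (J₀ : Finset (Fin m)) (w₁ w₂ : Finset (Fin n) × Finset (Fin m) × Bool), Terminal I r y J₀ w₁ w₂ →
      (∃ S ⊆ J₀, S.Nonempty ∧ (∀ w ∈ xverts I S, 2 ≤ xpdeg I S w) ∧ ∀ f ∈ S, ¬ IsChord I J₀ f) →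
      Covered I J₀ (w₁.2.1 ∪ w₂.2.1) →
      ∃ ℬ ⊆ J₀, ℬ.card + 2 ≤ (sharedSlots I J₀).card ∧
        ∀ c ∈ J₀, c ∉ ℬ → IsChord I J₀ c → OutsideGated I J₀ (w₁.2.1 ∪ w₂.2.1) c →
          NoSkeletalPathSumSubcore I r y J₀ c (w₁.2.1 ∪ w₂.2.1) ∧ NoShortCoincidence I J₀ c (internalMenu I J₀ (w₁.2.1 ∪ w₂.2.1))

/-- The covered bound gives the skeletal bound (terminal cores are covered). -/
theorem cleanSkeletalCriterionBound_of_covered (h : CleanCoveredCriterionBound) : CleanSkeletalCriterionBound :=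
  fun n m r I hI hT hS hB y J₀ w₁ w₂ ht hS₀ => h n m r I hI hT hS hB y J₀ w₁ w₂ ht hS₀ (covered_of_terminal hI hT hS hB ht)

/-- **THE CORE BOUND FROM O2 AND THE COVERED CRITERION BOUND.** -/
theorem terminalFive_of_coveredBound (hO2 : TerminalFiveA) (hb : CleanCoveredCriterionBound) : TerminalFive :=
  terminalFive_of_skeletalBound hO2 (cleanSkeletalCriterionBound_of_covered hb)

/-- **O1 from the same inputs.** -/
theorem terminalPeelable_of_coveredBound (hO2 : TerminalFiveA) (hb : CleanCoveredCriterionBound) : TerminalPeelable :=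
  terminalPeelable_of_terminalFive (terminalFive_of_coveredBound hO2 hb)

end Summit.PneNP.PneNP.Theorems.PstarNoFreeVertex
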